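import Literature.AlgebraicGeometry.Motives.MixedHodgeStructureAbelian
import Literature.AlgebraicGeometry.Motives.MixedHodgeStructureDual
import Literature.AlgebraicGeometry.HodgeTheory.WeightOneHodgeStructuresRealisedByTori
import HarnessLib

/-!
# Biduality of mixed Hodge structures: `H ≅ H^∨∨`

For a mixed `ℚ`-Hodge structure `H` on a finite-dimensional `V` and its dual MHS `H^∨` on `V^∨`
(`MixedHodgeStructure.dual`, `Motives/MixedHodgeStructureDual.lean`: `W_r(H^∨) = (W_{-r-1} H)^⊥`,
`F^p(H^∨) = (F^{1-p} H)^⊥`, Fujiki 1980 (1.6.2) a); Cattani–El Zein–Griffiths–Lê §3.2.2.7), the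
evaluation map `i_V : V → V^∨∨`, `v ↦ (φ ↦ φ v)`, is an isomorphism of mixed Hodge structures
`H ≅ (H^∨)^∨`: `W_k((H^∨)^∨) = ((W_k H)^⊥)^⊥ = i_V(W_k H)` and `F^p((H^∨)^∨) = ((F^p H)^⊥)^⊥ = i_V(F^p H)`.
This is the reflexivity of the objects of the rigid abelian tensor category of mixed Hodge structures
(Deligne, *Hodge II*, 1.1.6 and 2.3.5; Fujiki (1.6.2) a): "`ψ` gives a duality … iff the natural
isomorphism `H₁ ≅ H₂'` of vector spaces … gives that of mixed Hodge structures"); the pure case is the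
tree's `HodgeStructure.Hom.bidual` (`Motives/HodgeStructureInternalHomRigidity.lean`) and `HodgeStructure.evalHom`
(`HodgeTheory/WeightOneHodgeStructuresRealisedByTori.lean`).

## Main results (all proved; no named facts)

* (the pairing identity `⟨(i_V)_ℂ x, ξ⟩ = ⟨ξ, x⟩` is the tree's `HodgeStructure.dualBaseChange_baseChange_eval`,
  `HodgeTheory/WeightOneHodgeStructuresRealisedByTori.lean`, whose pure `evalHom` is the analogue of `Hom.bidual`.)
* **`MixedHodgeStructure.Hom.bidual H : Hom H H.dual.dual`** (underlying map `Module.Dual.eval ℚ V`),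
  `Hom.bidual_bijective`, the inverse morphism `Hom.bidualInv` with `bidualInv_comp_bidual`,
  `bidual_comp_bidualInv`.
* `dual_dual_W`, `dual_dual_F` — the filtrations of `H^∨∨` are the images of those of `H` under `i_V`.
* `Hom.transpose_transpose_comp_bidual` — naturality `f^∨∨ ∘ i = i ∘ f`;
  `Hom.transpose_injective_iff`, `Hom.transpose_surjective_iff`, `Hom.transpose_bijective_iff`.

## References

* [Fujiki1980] A. Fujiki, Duality of mixed Hodge structures of algebraic varieties, Publ. RIMS 16
  (1980), (1.6.1)–(1.6.2).
* [DeligneHodgeII1971] P. Deligne, Théorie de Hodge II, 1.1.6–1.1.7, Thm. 2.3.5.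
* [CattaniElZeinGriffithsLe2014] E. Cattani et al. (eds.), *Hodge Theory* (2014), §3.2.2.7, Thm. 3.2.18.
-/

noncomputable section

open scoped TensorProduct

namespace Literature.AlgebraicGeometry.Motives

namespace MixedHodgeStructure

universe u v

variable {V : Type u} [AddCommGroup V] [Module ℚ V]
variable {V' : Type v} [AddCommGroup V'] [Module ℚ V']

open Module
open HodgeStructure (dualBaseChange dualBaseChange_bijective dualBaseChange_baseChange_eval)

namespace Hom

/-- **The biduality morphism `i_V : H → H^∨∨`**, `v ↦ (φ ↦ φ v)` (`V` finite-dimensional): it maps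
`W_k` into `W_k(H^∨∨) = ((W_k)^⊥)^⊥` and `F^p` into `F^p(H^∨∨) = ((F^p)^⊥)^⊥`
(`HodgeStructure.dualBaseChange_baseChange_eval`). Fujiki (1.6.2) a): the natural isomorphism of vector spaces is one
of mixed Hodge structures. [cite: Fujiki1980, (1.6.2) a)] -/
def bidual [FiniteDimensional ℚ V] (H : MixedHodgeStructure V) : Hom H H.dual.dual where
  toLinearMap := Module.Dual.eval ℚ V
  map_W_le k := by
    rintro _ ⟨v, hv, rfl⟩
    rw [dual_W, Submodule.mem_dualAnnihilator]
    intro φ hφ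
    rw [dual_W, show -(-k - 1) - 1 = k by ring, Submodule.mem_dualAnnihilator] at hφ
    rw [Module.Dual.eval_apply]
    exact hφ v hv
  map_F_le p := by
    rintro _ ⟨x, hx, rfl⟩
    rw [dual_F, Submodule.mem_comap, Submodule.mem_dualAnnihilator]
    intro ξ hξ
    rw [dual_F, show 1 - (1 - p) = p by ring, Submodule.mem_comap, Submodule.mem_dualAnnihilator] at hξ
    rw [dualBaseChange_baseChange_eval]
    exact hξ x hx

/-- The underlying map of `i_V` is `Module.Dual.eval ℚ V`. [cite: Fujiki1980, (1.6.2) a)] -/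
@[simp]
theorem bidual_toLinearMap [FiniteDimensional ℚ V] (H : MixedHodgeStructure V) :
    (bidual H).toLinearMap = Module.Dual.eval ℚ V := rfl

/-- **`i_V : H → H^∨∨` is bijective** (`V` finite-dimensional, hence reflexive), so `H ≅ H^∨∨` as mixed
Hodge structures (`Hom.inverse`). [cite: Fujiki1980, (1.6.2) a)] -/
theorem bidual_bijective [FiniteDimensional ℚ V] (H : MixedHodgeStructure V) :
    Function.Bijective (bidual H).toLinearMap :=
  Module.bijective_dual_eval ℚ V

/-- The inverse isomorphism `H^∨∨ → H` of `i_V`. [cite: Fujiki1980, (1.6.2) a)] -/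
def bidualInv [FiniteDimensional ℚ V] (H : MixedHodgeStructure V) : Hom H.dual.dual H :=
  (bidual H).inverse (bidual_bijective H)

/-- `i_V⁻¹ ∘ i_V = id`. [cite: Fujiki1980, (1.6.2) a)] -/
theorem bidualInv_comp_bidual [FiniteDimensional ℚ V] (H : MixedHodgeStructure V) :
    (bidualInv H).comp (bidual H) = Hom.id H :=
  inverse_comp _ _

/-- `i_V ∘ i_V⁻¹ = id`. [cite: Fujiki1980, (1.6.2) a)] -/
theorem bidual_comp_bidualInv [FiniteDimensional ℚ V] (H : MixedHodgeStructure V) :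
    (bidual H).comp (bidualInv H) = Hom.id H.dual.dual :=
  comp_inverse _ _

end Hom

/-- **`W_k(H^∨∨) = i_V(W_k H)`**: `((W_k)^⊥)^⊥` is the image of `W_k` under evaluation.
[cite: Fujiki1980, (1.6.2) a)] -/
theorem dual_dual_W [FiniteDimensional ℚ V] (H : MixedHodgeStructure V) (k : ℤ) :
    H.dual.dual.W k = (H.W k).map (Module.Dual.eval ℚ V) := by
  rw [dual_W, dual_W, show -(-k - 1) - 1 = k by ring, Subspace.dualAnnihilator_dualAnnihilator_eq_map]

/-- **`F^p(H^∨∨) = (i_V)_ℂ(F^p H)`** (strictness of the bijective morphism `i_V`).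
[cite: Fujiki1980, (1.6.2) a)] -/
theorem dual_dual_F [FiniteDimensional ℚ V] (H : MixedHodgeStructure V) (p : ℤ) :
    H.dual.dual.F p = (H.F p).map ((Module.Dual.eval ℚ V).baseChange ℂ) := by
  rw [← Hom.bidual_toLinearMap H, (Hom.bidual H).map_F_eq p, LinearMap.range_eq_top.2
    (LinearMap.baseChange_surjective ℂ (Hom.bidual_bijective H).2), inf_top_eq]

namespace Hom

variable {H₁ : MixedHodgeStructure V} {H₂ : MixedHodgeStructure V'}

/-- **Naturality of biduality: `f^∨∨ ∘ i = i ∘ f`.** [cite: Fujiki1980, (1.6.2) a)] -/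
theorem transpose_transpose_comp_bidual [FiniteDimensional ℚ V] [FiniteDimensional ℚ V']
    (f : MixedHodgeStructure.Hom H₁ H₂) :
    f.transpose.transpose.comp (bidual H₁) = (bidual H₂).comp f :=
  Hom.ext (LinearMap.ext fun _ => rfl)

/-- `f^∨` is injective iff `f` is surjective. [cite: CattaniElZeinGriffithsLe2014, §3.2.2.7] -/
theorem transpose_injective_iff [FiniteDimensional ℚ V] [FiniteDimensional ℚ V']
    (f : MixedHodgeStructure.Hom H₁ H₂) :
    Function.Injective f.transpose.toLinearMap ↔ Function.Surjective f.toLinearMap :=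
  LinearMap.dualMap_injective_iff

/-- `f^∨` is surjective iff `f` is injective. [cite: CattaniElZeinGriffithsLe2014, §3.2.2.7] -/
theorem transpose_surjective_iff [FiniteDimensional ℚ V] [FiniteDimensional ℚ V']
    (f : MixedHodgeStructure.Hom H₁ H₂) :
    Function.Surjective f.transpose.toLinearMap ↔ Function.Injective f.toLinearMap :=
  LinearMap.dualMap_surjective_iff

/-- `f^∨` is an isomorphism iff `f` is. [cite: CattaniElZeinGriffithsLe2014, §3.2.2.7] -/
theorem transpose_bijective_iff [FiniteDimensional ℚ V] [FiniteDimensional ℚ V']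
    (f : MixedHodgeStructure.Hom H₁ H₂) :
    Function.Bijective f.transpose.toLinearMap ↔ Function.Bijective f.toLinearMap :=
  LinearMap.dualMap_bijective_iff

end Hom

end MixedHodgeStructure

end Literature.AlgebraicGeometry.Motives

end
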